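import Mathlib
import HarnessLib
import Literature.MathematicalPhysics.QuantumFieldTheory.ConstructiveQFTWave0
import Literature.Barriers.QuantumFields.ElitzurTheorem
import Literature.Probability.LatticeModels.LatticeGraph
import Literature.MathematicalPhysics.QuantumLattice.XYOrderGDProofs
import Literature.Combinatorics.SimpleGraph.EliminationGraph
import Summits.Ventures.LatticeQCDFlow.Exactness.LatticeCoordAvg
import Summits.Ventures.LatticeQCDFlow.Exactness.OpenBoundaryWilsonAction
import Summits.Ventures.LatticeQCDFlow.Scaling.EliminationFrontComponents
import Summits.Ventures.LatticeQCDFlow.Scaling.EliminationFrontRaster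
import Summits.Ventures.LatticeQCDFlow.Scaling.AutoregressiveMarkovContext

/-!
# LatticeQCDFlow / Scaling — instances of the frontier bound: (A) Wilson links — the exact
# autoregressive conditional of a link reads at most the link and its higher fill-neighbourhood in
# the PLAQUETTE-SHARING graph (the symbolic context of THEORY-2 §4 C5); (B) nearest-neighbour site
# fields (φ⁴ in gradient form, σ-models) — at most the site and its higher fill-neighbourhood in the
# torus graph

HONEST FRAMING: exact (Metropolis-corrected) sampling algorithms for lattice gauge theory;
figures of merit are autocorrelation/cost numbers at stated couplings and volumes; no
continuum-physics claim.

Venture `LatticeQCDFlow` (cell pub-lqcd), topic `Scaling`, FANOUT row 30 (lean-1, GEN-16) — OUR WORK,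
the two lattice instances of `Scaling/AutoregressiveMarkovContext` §5 (`arConditional_congr_of_higherAdj`:
the exact KR conditional of a weight factorising into positive bounded measurable clique terms reads
only the current variable and its higher fill-neighbourhood `adj⁺` in the elimination graph — THEORY-2
§4 T2-AF (a), the cited E27 upper bound, typed), in ANY linear order of the variables (generate from
the top; `s` = the variables below `a`):

* (A) WILSON LINKS — `dependsOn_wilsonPlaquetteTerm`, `wilsonWeight_eq_prod` (bookkeeping:
  `e^{−β S_W} = ∏_p e^{−β(N − Re tr ρ(U_p))}`, the term of `p` reading the four links
  `Exactness.plaquetteEdges p` of the tree's `Exactness/OpenBoundaryWilsonAction`);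
  **`wilson_arConditional_congr_of_higherAdj`** — compact second-countable `G`, continuous `ρ`, every
  real `β`, `d`, `L`: the exact conditional of `U_a` given the higher links (product Haar reference)
  takes the same value on configurations agreeing at `a` and on `adj⁺(a)` in the elimination graph of
  the PLAQUETTE-SHARING graph on links (inline `SimpleGraph.fromRel`: two distinct links are adjacent
  iff some plaquette contains both — the symbolic context `plaqNbhd`).
* (B) NEAREST-NEIGHBOUR SITE FIELDS (torus adjacency from the tree's
  `Literature.MathematicalPhysics.QuantumLattice.torusGraph_adj_add_single`);
  **`nearestNeighbour_arConditional_congr_of_higherAdj`** — sites of `(ℤ/L)^d` (`L ≥ 2`), values in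
  any measurable space with any reference probability measure, weight
  `∏_x g_x(φ_x) · ∏_{(x,i)} b_{x,i}(φ_x, φ_{x+e_i})` with positive bounded measurable factors (lattice
  `φ⁴` in gradient form `e^{−V(φ_x)}`, `e^{−κ(φ_x−φ_y)²/2}` with `V` bounded below; `O(N)`/`CP(N−1)`
  σ-models; any range-one ferromagnet): the exact conditional of `φ_a` given the higher sites takes the
  same value on configurations agreeing at `a` and on `adj⁺(a)` in the elimination graph of
  `torusGraph d L` (tree `Literature/Probability/LatticeModels/LatticeGraph`);
  **`nearestNeighbour_context_foldedRaster`** — in GEN-14's folded raster order that set has at most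
  `2·L^{d−1}` elements (`Scaling/EliminationFrontRaster`): SUB-EXTENSIVE CONTEXT `≤ 2L^{d−1} + 1` PER
  SITE SUFFICES for exact autoregressive sampling of every such field (T2-AF (a)/(b) upper half).

READING (value-free, THEORY-2 §4 C5 / T2-AF (a)): (A) is the SYMBOLIC upper bound for gauge links —
the one GEN-15/16 prove is NOT attained (buried links, forests, holonomy classes: the true context is
the symbolic one reduced by gauge); (B) with GEN-14 (free field: the context IS `adj⁺(a)`) brackets
C5 for scalar fields — ⊆ always, = for free fields, `φ⁴` proper open.  NOT CLAIMED: unbounded bond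
factors (`e^{+βφ_xφ_y}` form — rewrite in gradient form first); any lower bound; any number of ours.
Elementary over the parents; no definition is introduced; nothing is cited as a fact; no `sorry`.
-/

noncomputable section

namespace Summit.Ventures.LatticeQCDFlow.Theory2.Autoregressive

open MeasureTheory Function
open Literature.MathematicalPhysics.QuantumFieldTheory
open Summit.Ventures.LatticeQCDFlow.Exactness
open Literature.Combinatorics.SimpleGraph Literature.LinearAlgebra.Matrix.ChordalSparsity
open Literature.Probability.LatticeModels (TorusSite torusGraph torusGraph_adj_iff)
open Literature.MathematicalPhysics.QuantumLattice (torusGraph_adj_add_single)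

/-! ## (A) Wilson links: the plaquette-sharing graph -/

section Wilson

variable {d L N : ℕ} {G : Type*} [Group G]

/-- The plaquette term of the Wilson weight reads only the four links of its plaquette. [ours] -/
theorem dependsOn_wilsonPlaquetteTerm (ρ : G →* Matrix (Fin N) (Fin N) ℂ) (β : ℝ)
    (p : Plaquette d L) :
    DependsOn (fun U : GaugeConfig d L G =>
        Real.exp (-β * ((N : ℝ) - (ρ (plaquetteHolonomy U p.1 p.2.1.1 p.2.1.2)).trace.re)))
      (plaquetteEdges p : Set (Edge d L)) := by
  intro U V hUV
  have h1 := hUV (p.1, p.2.1.1) (by simp [plaquetteEdges])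
  have h2 := hUV (p.1.shift p.2.1.1, p.2.1.2) (by simp [plaquetteEdges])
  have h3 := hUV (p.1.shift p.2.1.2, p.2.1.1) (by simp [plaquetteEdges])
  have h4 := hUV (p.1, p.2.1.2) (by simp [plaquetteEdges])
  simp only [plaquetteHolonomy, h1, h2, h3, h4]

/-- The Wilson weight is the product of its plaquette terms: `e^{−β S_W} = ∏_p e^{−β(N − Re tr ρ(U_p))}`.
[ours] -/
theorem wilsonWeight_eq_prod [NeZero L] (ρ : G →* Matrix (Fin N) (Fin N) ℂ) (β : ℝ)
    (U : GaugeConfig d L G) :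
    Real.exp (-β * wilsonAction ρ U) =
      ∏ p : Plaquette d L,
        Real.exp (-β * ((N : ℝ) - (ρ (plaquetteHolonomy U p.1 p.2.1.1 p.2.1.2)).trace.re)) := by
  rw [wilsonAction, Finset.mul_sum, Real.exp_sum]

variable [TopologicalSpace G] [IsTopologicalGroup G] [CompactSpace G] [MeasurableSpace G]
  [BorelSpace G] [SecondCountableTopology G]

/-- **THE SYMBOLIC UPPER BOUND FOR GAUGE LINKS.**  Compact second-countable `G`, continuous `ρ`,
real `β`, any `d`, `L`, ANY linear order of the links; `s` = the links below `a` (not yet generated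
when generating from the top), product Haar reference.  If `U, U'` agree at `a` and on the higher
fill-neighbourhood `adj⁺(a)` of `a` in the elimination graph of the plaquette-sharing graph, then the
exact conditional `A_s w / A_{insert a s} w` of `U_a` given the higher links, `w = e^{−β S_W}`, takes
the same value at `U` and `U'`. [ours] -/
theorem wilson_arConditional_congr_of_higherAdj [NeZero L] [LinearOrder (Edge d L)]
    (ρ : G →* Matrix (Fin N) (Fin N) ℂ) (hρ : Continuous ρ) (β : ℝ) (a : Edge d L)
    {U U' : GaugeConfig d L G} (ha : U a = U' a)
    (h : ∀ e ∈ higherAdj (elimGraph (SimpleGraph.fromRel fun e e' : Edge d L =>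
        ∃ p : Plaquette d L, e ∈ plaquetteEdges p ∧ e' ∈ plaquetteEdges p)).Adj a, U e = U' e) :
    coordAvg (haarProbability G) (Finset.univ.filter (· < a))
          (fun V => Real.exp (-β * wilsonAction ρ V)) U /
        coordAvg (haarProbability G) (insert a (Finset.univ.filter (· < a)))
          (fun V => Real.exp (-β * wilsonAction ρ V)) U =
      coordAvg (haarProbability G) (Finset.univ.filter (· < a))
          (fun V => Real.exp (-β * wilsonAction ρ V)) U' /
        coordAvg (haarProbability G) (insert a (Finset.univ.filter (· < a)))
          (fun V => Real.exp (-β * wilsonAction ρ V)) U' := by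
  have hw : (fun V : GaugeConfig d L G => Real.exp (-β * wilsonAction ρ V)) =
      fun V => ∏ p : Plaquette d L,
        Real.exp (-β * ((N : ℝ) - (ρ (plaquetteHolonomy V p.1 p.2.1.1 p.2.1.2)).trace.re)) :=
    funext fun V => wilsonWeight_eq_prod ρ β V
  obtain ⟨M, -, hM⟩ := Literature.Barriers.QuantumFields.Elitzur.exists_abs_trace_re_le ρ hρ
  -- the hypotheses of the frontier theorem for the plaquette terms
  have hclique : ∀ (p : Plaquette d L), ∀ e ∈ plaquetteEdges p, ∀ e' ∈ plaquetteEdges p, e ≠ e' →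
      (SimpleGraph.fromRel fun e e' : Edge d L =>
        ∃ p : Plaquette d L, e ∈ plaquetteEdges p ∧ e' ∈ plaquetteEdges p).Adj e e' :=
    fun p e he e' he' hne => (SimpleGraph.fromRel_adj _ _ _).2 ⟨hne, Or.inl ⟨p, he, he'⟩⟩
  have hmeas : ∀ p : Plaquette d L, Measurable fun V : GaugeConfig d L G =>
      Real.exp (-β * ((N : ℝ) - (ρ (plaquetteHolonomy V p.1 p.2.1.1 p.2.1.2)).trace.re)) := by
    intro p
    have hc : Continuous fun V : GaugeConfig d L G => plaquetteHolonomy V p.1 p.2.1.1 p.2.1.2 := by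
      unfold plaquetteHolonomy; fun_prop
    exact (Real.continuous_exp.comp (continuous_const.mul (continuous_const.sub
      (Complex.continuous_re.comp (hρ.comp hc).matrix_trace)))).measurable
  have hbdd : ∀ p : Plaquette d L, ∃ C : ℝ, ∀ V : GaugeConfig d L G,
      Real.exp (-β * ((N : ℝ) - (ρ (plaquetteHolonomy V p.1 p.2.1.1 p.2.1.2)).trace.re)) ≤ C := by
    intro p
    refine ⟨Real.exp (|β| * ((N : ℝ) + M)), fun V => Real.exp_le_exp.2 ?_⟩
    set r : ℝ := (ρ (plaquetteHolonomy V p.1 p.2.1.1 p.2.1.2)).trace.re with hr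
    have h1 : |r| ≤ M := hM _
    have h2 : |(N : ℝ) - r| ≤ (N : ℝ) + M := by
      refine (abs_sub _ _).trans ?_
      rw [abs_of_nonneg (Nat.cast_nonneg N)]
      linarith
    calc -β * ((N : ℝ) - r) ≤ |-β * ((N : ℝ) - r)| := le_abs_self _
      _ = |β| * |(N : ℝ) - r| := by rw [abs_mul, abs_neg]
      _ ≤ |β| * ((N : ℝ) + M) := mul_le_mul_of_nonneg_left h2 (abs_nonneg β)
  have key := arConditional_congr_of_higherAdj (haarProbability G) _ a
    (fun (p : Plaquette d L) (V : GaugeConfig d L G) =>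
      Real.exp (-β * ((N : ℝ) - (ρ (plaquetteHolonomy V p.1 p.2.1.1 p.2.1.2)).trace.re)))
    plaquetteEdges (dependsOn_wilsonPlaquetteTerm ρ β) hclique hmeas (fun p V => Real.exp_pos _)
    hbdd ha h
  rw [hw]
  exact key

end Wilson

/-! ## (B) Nearest-neighbour site fields: the torus graph -/

section NearestNeighbour

variable {d L : ℕ} {X : Type*} [MeasurableSpace X] (μ : Measure X) [IsProbabilityMeasure μ]

/-- **THE CONTEXT OF A SITE IS CONTAINED IN ITS SYMBOLIC CONTEXT** (nearest-neighbour weights with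
positive bounded measurable site and bond factors; any reference probability measure; any linear
order of the sites; `L ≥ 2`).  If `φ, φ'` agree at `a` and on the higher fill-neighbourhood `adj⁺(a)`
of `a` in the elimination graph of `torusGraph d L`, the exact conditional `A_s w / A_{insert a s} w`
(`s` = the sites below `a`) of `φ_a` given the higher sites takes the same value at `φ` and `φ'`.
[ours] -/
theorem nearestNeighbour_arConditional_congr_of_higherAdj [NeZero L] [LinearOrder (TorusSite d L)]
    (hL : 2 ≤ L) (g : TorusSite d L → X → ℝ) (b : TorusSite d L → Fin d → X → X → ℝ)
    (hgm : ∀ x, Measurable (g x)) (hbm : ∀ x i, Measurable (uncurry (b x i)))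
    (hgpos : ∀ x v, 0 < g x v) (hbpos : ∀ x i v v', 0 < b x i v v')
    (hgbdd : ∀ x, ∃ C, ∀ v, g x v ≤ C) (hbbdd : ∀ x i, ∃ C, ∀ v v', b x i v v' ≤ C)
    (a : TorusSite d L) {φ φ' : TorusSite d L → X} (ha : φ a = φ' a)
    (h : ∀ y ∈ higherAdj (elimGraph (torusGraph d L)).Adj a, φ y = φ' y) :
    coordAvg μ (Finset.univ.filter (· < a))
          (fun ψ => (∏ x, g x (ψ x)) * ∏ e : TorusSite d L × Fin d,
            b e.1 e.2 (ψ e.1) (ψ (e.1 + Pi.single e.2 1))) φ /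
        coordAvg μ (insert a (Finset.univ.filter (· < a)))
          (fun ψ => (∏ x, g x (ψ x)) * ∏ e : TorusSite d L × Fin d,
            b e.1 e.2 (ψ e.1) (ψ (e.1 + Pi.single e.2 1))) φ =
      coordAvg μ (Finset.univ.filter (· < a))
          (fun ψ => (∏ x, g x (ψ x)) * ∏ e : TorusSite d L × Fin d,
            b e.1 e.2 (ψ e.1) (ψ (e.1 + Pi.single e.2 1))) φ' /
        coordAvg μ (insert a (Finset.univ.filter (· < a)))
          (fun ψ => (∏ x, g x (ψ x)) * ∏ e : TorusSite d L × Fin d,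
            b e.1 e.2 (ψ e.1) (ψ (e.1 + Pi.single e.2 1))) φ' := by
  classical
  -- terms: sites (`inl x`) and bonds (`inr (x, i)`)
  let f : TorusSite d L ⊕ TorusSite d L × Fin d → (TorusSite d L → X) → ℝ := fun t ψ =>
    match t with
    | Sum.inl x => g x (ψ x)
    | Sum.inr e => b e.1 e.2 (ψ e.1) (ψ (e.1 + Pi.single e.2 1))
  let rd : TorusSite d L ⊕ TorusSite d L × Fin d → Finset (TorusSite d L) := fun t =>
    match t with
    | Sum.inl x => {x}
    | Sum.inr e => {e.1, e.1 + Pi.single e.2 1}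
  have hw : (fun ψ : TorusSite d L → X => (∏ x, g x (ψ x)) * ∏ e : TorusSite d L × Fin d,
      b e.1 e.2 (ψ e.1) (ψ (e.1 + Pi.single e.2 1))) = fun ψ => ∏ t, f t ψ := by
    funext ψ
    rw [Fintype.prod_sum_type]
  have hf : ∀ t, DependsOn (f t) (rd t : Set (TorusSite d L)) := by
    rintro (x | e) ψ ψ' hψ
    · show g x (ψ x) = g x (ψ' x)
      rw [hψ x (by simp [rd])]
    · show b e.1 e.2 (ψ e.1) (ψ (e.1 + Pi.single e.2 1)) =
        b e.1 e.2 (ψ' e.1) (ψ' (e.1 + Pi.single e.2 1))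
      rw [hψ e.1 (by simp [rd]), hψ (e.1 + Pi.single e.2 1) (by simp [rd])]
  have hclique : ∀ t, ∀ i ∈ rd t, ∀ j ∈ rd t, i ≠ j → (torusGraph d L).Adj i j := by
    rintro (x | e) i hi j hj hij
    · simp only [rd, Finset.mem_singleton] at hi hj
      exact absurd (hi.trans hj.symm) hij
    · simp only [rd, Finset.mem_insert, Finset.mem_singleton] at hi hj
      have hadj := torusGraph_adj_add_single (hL2 := hL) (x := e.1) (i := e.2)
      rcases hi with rfl | rfl <;> rcases hj with rfl | rfl
      · exact absurd rfl hij
      · exact hadj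
      · exact hadj.symm
      · exact absurd rfl hij
  have hmeas : ∀ t, Measurable (f t) := by
    rintro (x | e)
    · exact (hgm x).comp (measurable_pi_apply x)
    · show Measurable (uncurry (b e.1 e.2) ∘
        fun ψ : TorusSite d L → X => (ψ e.1, ψ (e.1 + Pi.single e.2 1)))
      exact (hbm e.1 e.2).comp
        ((measurable_pi_apply e.1).prodMk (measurable_pi_apply (e.1 + Pi.single e.2 1)))
  have hpos : ∀ t ψ, 0 < f t ψ := by
    rintro (x | e) ψ
    · exact hgpos x _
    · exact hbpos e.1 e.2 _ _
  have hbdd : ∀ t, ∃ C, ∀ ψ, f t ψ ≤ C := by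
    rintro (x | e)
    · obtain ⟨C, hC⟩ := hgbdd x
      exact ⟨C, fun ψ => hC _⟩
    · obtain ⟨C, hC⟩ := hbbdd e.1 e.2
      exact ⟨C, fun ψ => hC _ _⟩
  rw [hw]
  exact arConditional_congr_of_higherAdj μ (torusGraph d L) a f rd hf hclique hmeas hpos hbdd ha h

/-- **SUB-EXTENSIVE CONTEXT SUFFICES FOR EXACT AUTOREGRESSIVE SAMPLING OF A NEAREST-NEIGHBOUR
FIELD**: in GEN-14's FOLDED RASTER order of the sites of `(ℤ/L)^d` (`L ≥ 2`) the higher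
fill-neighbourhood of every site has at most `2·L^{d−1}` elements
(`torus_elimWidth_foldedRaster_le`), and by the frontier bound the exact conditional of `φ_a` given
the higher sites reads only `a` and that set — an exact sampler visiting the sites in (reverse) folded
raster order needs context `≤ 2·L^{d−1} + 1` per site, for every nearest-neighbour weight with
positive bounded measurable factors (THEORY-2 T2-AF (a)/(b): the `O(V^{1−1/d})` upper half, typed;
the matching `Ω(L^{d−1})` lower half for the free field is GEN-14's `freeField_context_law`). [ours] -/
theorem nearestNeighbour_context_foldedRaster [NeZero L] (hL : 2 ≤ L) (g : TorusSite d L → X → ℝ)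
    (b : TorusSite d L → Fin d → X → X → ℝ)
    (hgm : ∀ x, Measurable (g x)) (hbm : ∀ x i, Measurable (uncurry (b x i)))
    (hgpos : ∀ x v, 0 < g x v) (hbpos : ∀ x i v v', 0 < b x i v v')
    (hgbdd : ∀ x, ∃ C, ∀ v, g x v ≤ C) (hbbdd : ∀ x i, ∃ C, ∀ v v', b x i v v' ≤ C)
    (a : TorusSite d L) :
    letI := foldedRasterOrder d L
    (higherAdj (elimGraph (torusGraph d L)).Adj a).ncard ≤ 2 * L ^ (d - 1) ∧
      ∀ {φ φ' : TorusSite d L → X}, φ a = φ' a →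
        (∀ y ∈ higherAdj (elimGraph (torusGraph d L)).Adj a, φ y = φ' y) →
          coordAvg μ (Finset.univ.filter (· < a))
                (fun ψ => (∏ x, g x (ψ x)) * ∏ e : TorusSite d L × Fin d,
                  b e.1 e.2 (ψ e.1) (ψ (e.1 + Pi.single e.2 1))) φ /
              coordAvg μ (insert a (Finset.univ.filter (· < a)))
                (fun ψ => (∏ x, g x (ψ x)) * ∏ e : TorusSite d L × Fin d,
                  b e.1 e.2 (ψ e.1) (ψ (e.1 + Pi.single e.2 1))) φ =
            coordAvg μ (Finset.univ.filter (· < a))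
                (fun ψ => (∏ x, g x (ψ x)) * ∏ e : TorusSite d L × Fin d,
                  b e.1 e.2 (ψ e.1) (ψ (e.1 + Pi.single e.2 1))) φ' /
              coordAvg μ (insert a (Finset.univ.filter (· < a)))
                (fun ψ => (∏ x, g x (ψ x)) * ∏ e : TorusSite d L × Fin d,
                  b e.1 e.2 (ψ e.1) (ψ (e.1 + Pi.single e.2 1))) φ' := by
  letI : LinearOrder (TorusSite d L) := foldedRasterOrder d L
  exact ⟨(ncard_higherAdj_elimGraph_le_elimWidth a).trans (torus_elimWidth_foldedRaster_le hL),
    fun ha h => nearestNeighbour_arConditional_congr_of_higherAdj μ hL g b hgm hbm hgpos hbpos hgbdd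
      hbbdd a ha h⟩

end NearestNeighbour

end Summit.Ventures.LatticeQCDFlow.Theory2.Autoregressive

end
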